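import Summits.BirchSwinnertonDyer.Rank1Residual.F1Sign2.UnitLocusAtTwo
import Literature.NumberTheory.EllipticCurves.Kobayashi2003.SignedSelmer
import HarnessLib

/-!
# Cell `bsd-f1-sign2` (`p = 2`, non-CM) — candidate ES-C-B `FlatSignedDualTrivialOfUnitAtTwo`: on the
# unit locus at a good supersingular `2` with `a₂ = 0`, Kobayashi's signed dual of the CLEAN sign
# `ε = 1` is ZERO (`X⁺(E/ℚ_∞) = 0`) — typed candidate of the Euler-system lens (seat `-es`)

HONEST FRAMING (typer seat `bsd-f1-sign2-ty`; HOME `run/shared/lean/pub/bsd-f1-sign2/`, CANDIDATES.md §2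
row ES-C-B): STATEMENT ONLY — one `@[conjecture] def` (OPEN obligation, our candidate, NOT a published
theorem); nothing asserted, nothing booked, no named fact, PARTITION: none moved. Source:
`HOME/data-es/Sketch.lean` sha16 bcb79e6976fcc0bd, decl `FlatSignedDualTrivialOfUnitAtTwo`, re-filed
VERBATIM. REFUTER PASS: REF1-AUDIT-v1.md §1 — **SURVIVES**: trap T10 discharged because
`SignedSelmerDualData.toDual` is a BIJECTION onto `Hom(signedSelmerInfty W κ 1, ℚ/ℤ)`, so
`Subsingleton D.X ⟺ Sel^{ε=1}(E/ℚ_∞) = 0` is a statement about a DEFINED tree object and the `∀ D` is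
inhabited (`Kobayashi2003.nonempty_signedSelmerDualData`); the hypothesis `¬ 2 ∣ Tam` is implied by the
unit hypothesis under ES-C-A(→) (possibly redundant, kept verbatim); the convention riding underneath is
`ε = 1 ↔ kobayashiL 1 = Lminus = L♭` (`KobayashiMainConjecture.lean`, "Kobayashi's `L⁺` is the tree's
`L⁻`"): `X^{ε=1} = 0` is the natural consequence of «`L♭ ∈ Λˣ` + signed main conjecture + no finite
submodule» only under that pairing (MEMO-es §2 sign cross-walk). BC7 CLEAN. REF2: pending at filing.

BC5 WITNESS: the `a₂ = 0` unit locus of `HOME/data-es/TABLE-ES-UNIT-v1.tsv` 2a816f914e1323f9 has 116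
rows (good-ss `2`, `a₂ = 0`, rank `0`, `v₂(L/Ω_E) = 0`; `N ≡ 3, 5 (mod 8)` on 116/116, `λ♭ = μ♭ = 0`
certified 116/116); the Λ-module statement itself has no table column (it is the Λ-form of ES-C-A: «`m = 0`
in TP2 item 20308 and `Char X⁺ = Λ = (L♭)`» on this locus, MEMO-es §3). CHEAPEST FALSIFIER: a unit-locus
`a₂ = 0` curve with `Sel₂(E/ℚ_n) ≠ 0` at some layer `n` (none computed; layer `0` = data ask D1).
WHY NOVEL (MEMO-es §3; REF2 MAP v1.2 O1): every signed ALGEBRAIC object is printed for odd `p` only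
(Kobayashi 2003 p. 1; B. D. Kim; Kitajima–Otsuki); at `2` the only class-level Selmer theorem is
Kurihara–Otsuki 2006 Thm. 0.1 (`a₂ = ±2`, `Sel(E/ℚ_∞)^∨ ≅ Λ` for the FULL Selmer group), which says
nothing about Kobayashi's `Sel^±` at `a₂ = 0`.

References: [Kobayashi2003] Def. 1.1 (the object `Sel^±(E/ℚ_∞)`); [KuriharaOtsuki2006] Thm. 0.1;
HOME MEMO-es.md §§0, 2, 3; REF1-AUDIT-v1.md §1.
-/

set_option autoImplicit false

noncomputable section

open scoped Classical

open WeierstrassCurve Literature.NumberTheory.EllipticCurves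
  Literature.NumberTheory.EllipticCurves.Kobayashi2003 ZpExtension

namespace Summit.BirchSwinnertonDyer.Rank1Residual.F1Sign2

/-- **CANDIDATE ES-C-B `FlatSignedDualTrivialOfUnitAtTwo` (OPEN; cell `bsd-f1-sign2`, lens `-es`).**
For `E/ℚ` (globally minimal) with good reduction at `2`, `a₂ = 0`, `ord₂(L(E,1)/Ω_E) = 0`
(`UnitLValueAtTwo`) and `2 ∤ Tam(E)`: for the cyclotomic `ℤ₂`-extension `κ` with topological generator
`γ`, EVERY Pontryagin-dual datum `D` of Kobayashi's `Sel^{ε=1}(E/ℚ_∞)` (`SignedSelmerDualData W κ γ 1`,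
the tree's clean sign, paired with Sprung's `L♭`, `c♭ = 1`) has `X⁺(E/ℚ_∞) = D.X = 0`
(`Subsingleton D.X`; by `toDual` bijective this says `Sel^{ε=1}(E/ℚ_∞) = 0`). The signed object of the
clean sign is TRIVIAL on the unit locus, at every layer, with no `2^m` slack (MEMO-es §0.4). REF1:
SURVIVES. [cite: Kobayashi2003, Def. 1.1 (the object); the statement at `p = 2` is NOT in print] -/
@[conjecture] def FlatSignedDualTrivialOfUnitAtTwo : Prop :=
  ∀ (W : WeierstrassCurve ℚ) [W.IsElliptic] [W.IsGloballyMinimal],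
    W.HasGoodReductionAtPrime 2 → W.frobeniusTrace 2 = 0 → UnitLValueAtTwo W → ¬ 2 ∣ W.tamagawaProduct →
    ∀ (κ : ZpExtension ℚ 2) (γ : Field.absoluteGaloisGroup ℚ), κ.IsCyclotomic → κ.IsTopGenerator γ →
    ∀ D : SignedSelmerDualData W κ γ 1, Subsingleton D.X

end Summit.BirchSwinnertonDyer.Rank1Residual.F1Sign2

end
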